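import Literature.NumberTheory.GaloisRepresentations.ArtinRepresentationDifferentProofs
import HarnessLib

/-!
# Hasse–Arf, layer step I: traces of powers of `𝔓` in a totally ramified layer (Serre V §3, Lemmas 3–5)

Towards a completion-free proof of the Hasse–Arf theorem (`Literature.NumberTheory.GaloisRepresentations.hasseArf`)
along Serre, *Local Fields*, Ch. V §3, §6, §7.  Setting (global, as everywhere in this directory):
`R` Dedekind with fraction field `K`, `L/K` finite Galois with group `G`, `S = S_L = integralClosure R L`,
`𝔓 ≠ 0` a maximal ideal of `S` with separable residue extension, and an intermediate field `F`
whose group `Γ = Gal(L/F) = F.fixingSubgroup` is contained in the inertia group of `𝔓`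
(the layer `L/F` is *totally ramified at `𝔓`*: `𝔓` is the only prime of `S` over
`𝔓_F = 𝔓 ∩ S_F`, `e(𝔓 | 𝔓_F) = |Γ|`, and the residue extension of `𝔓 | 𝔓_F` is trivial).
Everything is expressed inside `S`: the trace `Tr_Γ(y) = Σ_{γ ∈ Γ} γ y ∈ S` and the norm
`N_Γ(y) = ∏_{γ ∈ Γ} γ y ∈ S` of `y ∈ S` (both `Γ`-invariant, i.e. in `S_F`), and
"`z ∈ 𝔓_F^r`" for a `Γ`-invariant `z` is written `z ∈ 𝔓 ^ (|Γ| r)`.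

* `sum_smul_eq_algebraMap_trace`, `prod_smul_eq_algebraMap_norm`: `Tr_Γ`, `N_Γ` are the field
  trace and norm of `L/F` (Mathlib `trace_eq_sum_automorphisms`, `norm_eq_prod_automorphisms`).
* `exists_generator_mem` : a local generator `x ∈ 𝔓` of `S` over `S_F` at `𝔓`
  (`d S ⊆ S_F[x]`, `d ∉ 𝔓`; Serre III §6 Prop. 12 in the global form of `HerbrandQuotientFormula`,
  shifted by an inertia-fixed representative of its residue class).
* `sum_smul_mem_pow_of_mem_pow` (**Serre V §3 Lemma 4, inclusion half**, for a layer of any degree):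
  `y ∈ 𝔓 ^ j ⟹ Tr_Γ(y) ∈ 𝔓 ^ (|Γ| ⌊(j + d)/|Γ|⌋)` where `d = Σ_{γ ≠ 1} i_G(γ) = v_𝔓(𝔇_{L/F})`,
  from `dual(S_F[x]) = f'(x)⁻¹ S_F[x]` (Mathlib `traceForm_dualSubmodule_adjoin`, Euler) —
  Serre's proof via Ch. III §3 Prop. 7, made local at `𝔓` by hand.
* `exists_sum_smul_sub_mem_pow` (**Lemma 4, equality half**, approximate form): every
  `Γ`-invariant `z ∈ 𝔓 ^ (|Γ| r)`, `r = ⌊(j+d)/|Γ|⌋`, is `≡ Tr_Γ(y) mod 𝔓 ^ (|Γ|(r+1))` for some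
  `y ∈ 𝔓 ^ j` (Euler: `Tr(x^{n-1}/f'(x)) = 1`).
* `norm_one_add_sub_mem` (**Serre V §3 Lemma 5** for `|Γ| = ℓ` prime):
  `N(1 + y) - 1 - Tr(y) - N(y) = Tr(w)` with `w ∈ 𝔓 ^ (2m)` for `y ∈ 𝔓 ^ m`
  (the other terms of `∏ (1 + γ y)` are grouped along the free `Γ`-orbits of the `k`-subsets,
  `2 ≤ k ≤ ℓ - 1`).

The consequences for the norm map on the unit filtration (Serre V §3 Props. 4–5) are drawn in
`HasseArfLayerNorm.lean`.

## References

* J.-P. Serre, *Local Fields*, GTM 67, Springer 1979: Ch. III §3 Prop. 7, §6 Prop. 11–12;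
  Ch. IV §1 Prop. 4; Ch. V §3, Lemmas 3, 4, 5 (pp. 83–84). [SerreLocalFields1979]
-/

open Polynomial
open scoped Pointwise

noncomputable section

namespace Literature.NumberTheory.GaloisRepresentations

attribute [local instance] FractionRing.liftAlgebra FractionRing.isScalarTower_liftAlgebra

variable (R : Type*) {K L : Type*} [CommRing R] [Field K] [Field L] [Algebra R K] [Algebra R L]
  [Algebra K L] [IsScalarTower R K L]

attribute [local instance] integralClosureAlgebra integralClosure_isScalarTower_left
  integralClosure_isScalarTower_bot integralClosure_faithfulSMul integralClosure_isIntegral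
  integralClosure_isTorsionFree isMaximal_under_integralClosure under_integralClosure_liesOver
  residueAlgebra residueSMul isScalarTower_residue

/-! ### `Tr_Γ` and `N_Γ` are the trace and the norm of `L/F` -/

section TraceNorm

variable (F : IntermediateField K L) [FiniteDimensional K L] [IsGalois K L]

/-- `Σ_{γ ∈ Gal(L/F)} γ y = Tr_{L/F}(y)` (as elements of `L`), the sum taken over the subgroup
`F.fixingSubgroup ≤ Gal(L/K)`.  Ref: Serre, *Local Fields*, Ch. V §2 (formula (*)), Mathlib
`trace_eq_sum_automorphisms`. [folklore] -/
theorem sum_smul_eq_algebraMap_trace [Fintype F.fixingSubgroup] (y : L) :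
    ∑ γ : F.fixingSubgroup, (γ : L ≃ₐ[K] L) y = algebraMap F L (Algebra.trace F L y) := by
  rw [trace_eq_sum_automorphisms,
    ← Fintype.sum_equiv (IntermediateField.fixingSubgroupEquiv F).toEquiv _ _ fun _ => rfl]
  rfl

/-- `∏_{γ ∈ Gal(L/F)} γ y = N_{L/F}(y)` (as elements of `L`).  Ref: Mathlib
`Algebra.norm_eq_prod_automorphisms`. [folklore] -/
theorem prod_smul_eq_algebraMap_norm [Fintype F.fixingSubgroup] (y : L) :
    ∏ γ : F.fixingSubgroup, (γ : L ≃ₐ[K] L) y = algebraMap F L (Algebra.norm F y) := by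
  rw [Algebra.norm_eq_prod_automorphisms,
    ← Fintype.prod_equiv (IntermediateField.fixingSubgroupEquiv F).toEquiv _ _ fun _ => rfl]
  rfl

end TraceNorm

/-! ### A local generator of `S` over `S_F` at `𝔓`, lying in `𝔓` -/

section Generator

variable (F : IntermediateField K L) [IsDedekindDomain R] [IsFractionRing R K]
  [FiniteDimensional K L] [IsGalois K L]
  (𝔓 : Ideal (integralClosure R L)) [𝔓.IsMaximal]

/-- **A local generator in `𝔓`.**  If `Γ = Gal(L/F)` is contained in the inertia group of the
maximal ideal `𝔓 ≠ 0` of `S = S_L` (residue extension of `𝔓` over `R` separable), there are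
`x ∈ 𝔓` and `d ∈ S_F` with `d ∉ 𝔓` and `d S ⊆ S_F[x]`.  This is Serre's `A_L = A_K[x]`
(Ch. III §6 Prop. 12) in the global form `exists_generator_smul_mem_adjoin`, with `x` replaced by
`x - a` for an inertia-fixed (hence `Γ`-fixed, i.e. `S_F`-rational) representative `a` of its
residue class (`exists_inertia_fixed_sub_mem`): `S_F[x - a] = S_F[x]`.
Ref: Serre, *Local Fields*, Ch. III §6, Prop. 12; Ch. I §7 Prop. 21 c).
[cite: SerreLocalFields1979, Ch. III §6 Prop. 12] -/
theorem exists_generator_mem (h𝔓 : 𝔓 ≠ ⊥)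
    [Algebra.IsSeparable (R ⧸ 𝔓.under R) (integralClosure R L ⧸ 𝔓)]
    (hF : F.fixingSubgroup ≤ 𝔓.inertia (L ≃ₐ[K] L)) :
    ∃ (x : integralClosure R L) (d : integralClosure R F), x ∈ 𝔓 ∧
      algebraMap (integralClosure R F) (integralClosure R L) d ∉ 𝔓 ∧
      ∀ b : integralClosure R L, ∃ P : (integralClosure R F)[X], d • b = aeval x P := by
  classical
  haveI : FaithfulSMul (L ≃ₐ[K] L) (integralClosure R L) := faithfulSMul_algEquiv_integralClosure R
  haveI hGal : IsGaloisGroup F.fixingSubgroup (integralClosure R F) (integralClosure R L) :=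
    isGaloisGroup_fixingSubgroup_integralClosure R F
  haveI : IsDedekindDomain (integralClosure R L) := integralClosure.isDedekindDomain R K L
  haveI := integralClosure_moduleFinite R F (K := K) (L := L)
  haveI : SMulCommClass F.fixingSubgroup (integralClosure R F) (integralClosure R L) :=
    hGal.commutes
  haveI : Algebra.IsInvariant (integralClosure R F) (integralClosure R L) F.fixingSubgroup :=
    hGal.isInvariant
  haveI : Algebra.IsSeparable (integralClosure R F ⧸ 𝔓.under (integralClosure R F))
      (integralClosure R L ⧸ 𝔓) := isSeparable_residue_top R F 𝔓
  have hstab : ∀ g : F.fixingSubgroup, g • 𝔓 = 𝔓 := fun g =>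
    (Ideal.inertia_le_stabilizer 𝔓) (hF g.2)
  obtain ⟨x, d, hd, hgen⟩ :=
    exists_generator_smul_mem_adjoin (A := integralClosure R F) F.fixingSubgroup 𝔓 h𝔓 hstab
  -- an inertia-fixed representative of the residue class of `x` is `S_F`-rational
  haveI : 𝔓.LiesOver (𝔓.under R) := ⟨rfl⟩
  obtain ⟨a₀, ha₀fix, hxa₀⟩ :=
    exists_inertia_fixed_sub_mem (L ≃ₐ[K] L) (𝔓.under R) 𝔓 x
  obtain ⟨a, ha⟩ : ∃ a : integralClosure R F,
      algebraMap (integralClosure R F) (integralClosure R L) a = a₀ :=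
    Algebra.IsInvariant.isInvariant (A := integralClosure R F) (G := F.fixingSubgroup) a₀
      fun g => ha₀fix g (hF g.2)
  refine ⟨x - a₀, d, hxa₀, hd, fun b => ?_⟩
  obtain ⟨P, hP⟩ := hgen b
  refine ⟨P.comp (X + C a), ?_⟩
  have hx : aeval (x - a₀) (X + C a : (integralClosure R F)[X]) = x := by
    rw [aeval_def, eval₂_add, eval₂_X, eval₂_C, ha, sub_add_cancel]
  rw [hP, aeval_comp, hx]

end Generator

/-! ### Total ramification: `𝔓_F S = 𝔓 ^ |Γ|` -/

section TotallyRamified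

variable (F : IntermediateField K L) [IsDedekindDomain R] [IsFractionRing R K]
  [FiniteDimensional K L] [IsGalois K L]
  (𝔓 : Ideal (integralClosure R L)) [𝔓.IsMaximal]

/-- **`𝔓_F S = 𝔓 ^ |Γ|` for a layer totally ramified at `𝔓`.**  If `Γ = Gal(L/F)` lies in the
inertia group of `𝔓 ≠ 0` (residue extension of `𝔓` over `R` separable), then the extension to
`S = S_L` of `𝔓_F = 𝔓 ∩ S_F` is `𝔓 ^ |Γ|`: `𝔓` is the only prime over `𝔓_F` (the primes over
`𝔓_F` are permuted transitively by `Γ`, which fixes `𝔓`) and `e(𝔓 | 𝔓_F) = |T_𝔓 ∩ Γ| = |Γ|`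
(`ramificationIdx'_under_eq_card_inertia`).
Ref: Serre, *Local Fields*, Ch. I §7, Prop. 21 a) and Cor. (`[L : K_T] = e`); Ch. V §3
("`L/K` is totally ramified"). [cite: SerreLocalFields1979, Ch. I §7 Prop. 21–22] -/
theorem map_under_eq_pow_card [Fintype F.fixingSubgroup] (h𝔓 : 𝔓 ≠ ⊥)
    [Algebra.IsSeparable (R ⧸ 𝔓.under R) (integralClosure R L ⧸ 𝔓)]
    (hF : F.fixingSubgroup ≤ 𝔓.inertia (L ≃ₐ[K] L)) :
    (𝔓.under (integralClosure R F)).map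
        (algebraMap (integralClosure R F) (integralClosure R L)) =
      𝔓 ^ Fintype.card F.fixingSubgroup := by
  classical
  haveI : FaithfulSMul (L ≃ₐ[K] L) (integralClosure R L) := faithfulSMul_algEquiv_integralClosure R
  haveI hGal : IsGaloisGroup F.fixingSubgroup (integralClosure R F) (integralClosure R L) :=
    isGaloisGroup_fixingSubgroup_integralClosure R F
  haveI : IsDedekindDomain (integralClosure R L) := integralClosure.isDedekindDomain R K L
  haveI : IsDedekindDomain (integralClosure R F) := integralClosure.isDedekindDomain R K F
  haveI : SMulCommClass F.fixingSubgroup (integralClosure R F) (integralClosure R L) :=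
    hGal.commutes
  haveI : Algebra.IsInvariant (integralClosure R F) (integralClosure R L) F.fixingSubgroup :=
    hGal.isInvariant
  haveI : Algebra.IsIntegral (integralClosure R F) (integralClosure R L) :=
    Algebra.IsInvariant.isIntegral _ _ F.fixingSubgroup
  have hstab : ∀ g : F.fixingSubgroup, g • 𝔓 = 𝔓 := fun g =>
    (Ideal.inertia_le_stabilizer 𝔓) (hF g.2)
  haveI h𝔭max : (𝔓.under (integralClosure R F)).IsMaximal := Ideal.IsMaximal.under _ 𝔓
  -- the extended ideal is a power of `𝔓`
  set I := (𝔓.under (integralClosure R F)).map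
    (algebraMap (integralClosure R F) (integralClosure R L)) with hI
  have hne : I ≠ ⊥ := map_under_ne_bot (integralClosure R F) F.fixingSubgroup 𝔓 h𝔓
  have hall : ∀ Q ∈ UniqueFactorizationMonoid.normalizedFactors I, Q = 𝔓 := by
    intro Q hQ
    haveI hQprime : Q.IsPrime := Ideal.isPrime_of_prime
      (UniqueFactorizationMonoid.prime_of_normalized_factor Q hQ)
    have hQle : I ≤ Q :=
      Ideal.dvd_iff_le.mp (UniqueFactorizationMonoid.dvd_of_mem_normalizedFactors hQ)
    have hQunder : Q.under (integralClosure R F) = 𝔓.under (integralClosure R F) :=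
      (h𝔭max.eq_of_le (Ideal.IsPrime.ne_top inferInstance)
        (Ideal.map_le_iff_le_comap.mp hQle)).symm
    obtain ⟨g, hg⟩ := Algebra.IsInvariant.exists_smul_of_under_eq (integralClosure R F)
      (integralClosure R L) F.fixingSubgroup 𝔓 Q hQunder.symm
    rw [hg]
    exact hstab g
  set m := (UniqueFactorizationMonoid.normalizedFactors I).card with hm
  have hIm : I = 𝔓 ^ m := by
    conv_lhs => rw [← Ideal.prod_normalizedFactors_eq_self hne,
      Multiset.eq_replicate_of_mem hall, Multiset.prod_replicate]
  -- its exponent is the ramification index, `= |T ∩ Γ| = |Γ|`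
  have h𝔓top : 𝔓 ≠ ⊤ := Ideal.IsMaximal.ne_top inferInstance
  have hanti := Ideal.pow_right_strictAnti 𝔓 h𝔓 h𝔓top
  have hidx : (𝔓.under (integralClosure R F)).ramificationIdx' 𝔓 = m :=
    Ideal.ramificationIdx'_spec (le_of_eq hIm) fun hle => by
      have : 𝔓 ^ (m + 1) < 𝔓 ^ m := hanti (Nat.lt_succ_self m)
      exact absurd (hIm ▸ hle) (not_le_of_gt this)
  have hcard : (𝔓.under (integralClosure R F)).ramificationIdx' 𝔓 =
      Fintype.card F.fixingSubgroup := by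
    rw [ramificationIdx'_under_eq_card_inertia R F 𝔓 h𝔓, ← Nat.card_eq_fintype_card]
    have htop : 𝔓.inertia F.fixingSubgroup = ⊤ := by
      refine eq_top_iff.mpr fun g _ => ?_
      exact (AddSubgroup.mem_inertia (I := 𝔓.toAddSubgroup)).mpr fun z =>
        (AddSubgroup.mem_inertia (I := 𝔓.toAddSubgroup)).mp (hF g.2) z
    rw [htop, Subgroup.card_top]
  rw [hIm, ← hidx, hcard]

end TotallyRamified

/-! ### The minimal polynomial of a local generator and the different exponent `d` -/

section MinpolyGenerator

variable (F : IntermediateField K L) [IsDedekindDomain R] [IsFractionRing R K]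
  [FiniteDimensional K L] [IsGalois K L]
  (𝔓 : Ideal (integralClosure R L)) [𝔓.IsMaximal]

/-- **The minimal polynomial of a local generator.**  For `x`, `d` as in `exists_generator_mem`
(`d S ⊆ S_F[x]`, `d ∉ 𝔓`, `Γ = Gal(L/F)` fixing `𝔓 ≠ 0`): the minimal polynomial of `x` over
`S_F` is `∏_{γ ∈ Γ} (X - γ x)` (the `γ x` are pairwise distinct since `i_G(γ) = v_𝔓(γ x - x) < ∞`
for `γ ≠ 1`), `x` generates `L` over `F`, and `f'(x) = ∏_{γ ≠ 1} (x - γ x)`.  (Extracted from the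
proof of `emultiplicity_differentIdeal_eq_finsum_lowerIndex`.)
Ref: Serre, *Local Fields*, Ch. III §6 Prop. 12, Ch. IV §1 Prop. 4 (proof).
[cite: SerreLocalFields1979, Ch. IV §1 Prop. 4] -/
theorem minpoly_generator [Fintype F.fixingSubgroup] [DecidableEq F.fixingSubgroup] (h𝔓 : 𝔓 ≠ ⊥)
    (hF : F.fixingSubgroup ≤ 𝔓.inertia (L ≃ₐ[K] L))
    {x : integralClosure R L} {d : integralClosure R F}
    (hd : algebraMap (integralClosure R F) (integralClosure R L) d ∉ 𝔓)
    (hgen : ∀ b : integralClosure R L, ∃ P : (integralClosure R F)[X], d • b = aeval x P) :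
    (minpoly (integralClosure R F) x).map
        (algebraMap (integralClosure R F) (integralClosure R L)) =
        ∏ γ : F.fixingSubgroup, (X - C ((γ : L ≃ₐ[K] L) • x)) ∧
      Algebra.adjoin F {((x : integralClosure R L) : L)} = ⊤ ∧
      aeval x (derivative (minpoly (integralClosure R F) x)) =
        ∏ γ ∈ (Finset.univ : Finset F.fixingSubgroup).erase 1, (x - (γ : L ≃ₐ[K] L) • x) := by
  classical
  haveI : FaithfulSMul (L ≃ₐ[K] L) (integralClosure R L) := faithfulSMul_algEquiv_integralClosure R
  haveI hGal : IsGaloisGroup F.fixingSubgroup (integralClosure R F) (integralClosure R L) :=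
    isGaloisGroup_fixingSubgroup_integralClosure R F
  haveI : IsDedekindDomain (integralClosure R L) := integralClosure.isDedekindDomain R K L
  haveI : IsDedekindDomain (integralClosure R F) := integralClosure.isDedekindDomain R K F
  haveI : IsFractionRing (integralClosure R F) F :=
    integralClosure.isFractionRing_of_finite_extension K F
  haveI : SMulCommClass F.fixingSubgroup (integralClosure R F) (integralClosure R L) :=
    hGal.commutes
  haveI : Algebra.IsInvariant (integralClosure R F) (integralClosure R L) F.fixingSubgroup :=
    hGal.isInvariant
  haveI : Algebra.IsIntegral (integralClosure R F) (integralClosure R L) :=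
    Algebra.IsInvariant.isIntegral _ _ F.fixingSubgroup
  haveI h𝔓prime : 𝔓.IsPrime := Ideal.IsMaximal.isPrime inferInstance
  have hstab : ∀ g : F.fixingSubgroup, g • 𝔓 = 𝔓 := fun g =>
    (Ideal.inertia_le_stabilizer 𝔓) (hF g.2)
  have hi : ∀ g : F.fixingSubgroup,
      lowerIndex 𝔓 F.fixingSubgroup g = ordIdeal 𝔓 (g • x - x) :=
    lowerIndex_eq_ordIdeal h𝔓 hstab hd hgen
  obtain ⟨Nb, hNb⟩ := Ideal.ramificationSubgroup_eventually_eq_bot_holds 𝔓 (L ≃ₐ[K] L)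
    (Ideal.IsMaximal.ne_top inferInstance)
  have hne1 : ∀ g : F.fixingSubgroup, g ≠ 1 → g • x ≠ x := fun g hg h => by
    have h1 : (g : L ≃ₐ[K] L) ≠ 1 := fun h' => hg (Subtype.ext h')
    refine lowerIndex_ne_top 𝔓 (hNb Nb le_rfl) h1 ?_
    rw [← lowerIndex_subgroup, hi g, h, sub_self, ordIdeal_zero]
  have hinj : Function.Injective fun g : F.fixingSubgroup => g • x := by
    intro g₁ g₂ h
    have : (g₂⁻¹ * g₁) • x = x := by rw [mul_smul, show g₁ • x = g₂ • x from h, inv_smul_smul]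
    by_contra hne
    exact hne1 (g₂⁻¹ * g₁) (fun h' => hne (inv_mul_eq_one.mp h').symm) this
  set Q : (integralClosure R L)[X] := ∏ g : F.fixingSubgroup, (X - C (g • x)) with hQ
  have hQmonic : Q.Monic := monic_prod_of_monic _ _ fun g _ => monic_X_sub_C _
  have hQdeg : Q.natDegree = Fintype.card F.fixingSubgroup := by
    rw [hQ, natDegree_prod_of_monic _ _ fun g _ => monic_X_sub_C _]
    simp
  have hxint : IsIntegral (integralClosure R F) x := Algebra.IsIntegral.isIntegral x
  set P := minpoly (integralClosure R F) x with hP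
  have hPmonic : P.Monic := minpoly.monic hxint
  have hQeq : Q = (Multiset.map (fun a => X - C a)
      ((Finset.univ : Finset F.fixingSubgroup).val.map fun g => g • x)).prod := by
    rw [hQ, Finset.prod_eq_multiset_prod, Multiset.map_map]; rfl
  have hdvd : Q ∣ P.map (algebraMap (integralClosure R F) (integralClosure R L)) := by
    rw [hQeq, Multiset.prod_X_sub_C_dvd_iff_le_roots (hPmonic.map _).ne_zero,
      Multiset.le_iff_subset ((Finset.univ : Finset F.fixingSubgroup).nodup.map hinj)]
    intro a ha
    obtain ⟨g, -, rfl⟩ := Multiset.mem_map.mp ha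
    rw [mem_roots (hPmonic.map _).ne_zero, IsRoot.def, eval_map_algebraMap, ← smul_aeval, hP,
      minpoly.aeval, smul_zero]
  have hfin : Module.finrank F L = Fintype.card F.fixingSubgroup := by
    rw [← Nat.card_eq_fintype_card]; exact (IsGalois.card_fixingSubgroup_eq_finrank F).symm
  have hPx : minpoly F (x : L) = P.map (algebraMap (integralClosure R F) F) := by
    rw [hP, ← minpoly.algebraMap_eq (FaithfulSMul.algebraMap_injective (integralClosure R L) L) x]
    exact minpoly.isIntegrallyClosed_eq_field_fractions' F hxint.algebraMap
  have hdegP : P.natDegree ≤ Fintype.card F.fixingSubgroup := by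
    have h1 : (minpoly F (x : L)).natDegree ≤ Module.finrank F L := minpoly.natDegree_le (x : L)
    rwa [hPx, hPmonic.natDegree_map, hfin] at h1
  have hPQ : P.map (algebraMap (integralClosure R F) (integralClosure R L)) = Q :=
    eq_of_monic_of_dvd_of_natDegree_le hQmonic (hPmonic.map _) hdvd
      (by rw [hPmonic.natDegree_map, hQdeg]; exact hdegP)
  have hx : Algebra.adjoin F {((x : integralClosure R L) : L)} = ⊤ := by
    have hdeg : (minpoly F (x : L)).natDegree = Module.finrank F L := by
      rw [hPx, hPmonic.natDegree_map, hfin, ← hQdeg, ← hPQ, hPmonic.natDegree_map]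
    have htop := (Field.primitive_element_iff_minpoly_natDegree_eq F (x : L)).mpr hdeg
    have halg : IsAlgebraic F (x : L) := Algebra.IsAlgebraic.isAlgebraic _
    rw [← IntermediateField.adjoin_simple_toSubalgebra_of_isAlgebraic halg, htop,
      IntermediateField.top_toSubalgebra]
  have hder : aeval x (derivative P) =
      ∏ g ∈ (Finset.univ : Finset F.fixingSubgroup).erase 1, (x - g • x) := by
    rw [← eval_map_algebraMap, ← derivative_map, hPQ, hQeq]
    have hxmem : x ∈ (Finset.univ : Finset F.fixingSubgroup).val.map fun g => g • x :=
      Multiset.mem_map.mpr ⟨1, Finset.mem_univ_val _, one_smul _ _⟩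
    rw [eval_multiset_prod_X_sub_C_derivative hxmem]
    have herase : ((Finset.univ : Finset F.fixingSubgroup).val.map fun g => g • x).erase x =
        ((Finset.univ : Finset F.fixingSubgroup).erase 1).val.map fun g => g • x := by
      rw [Finset.erase_val, Multiset.map_erase _ hinj, one_smul]
    rw [herase, Finset.prod_eq_multiset_prod, Multiset.map_map]
    rfl
  exact ⟨hPQ, hx, hder⟩

/-- **The different exponent of the layer at `𝔓`**: `v_𝔓(f'(x)) = Σ_{γ ∈ Γ, γ ≠ 1} i_G(γ)` for
a local generator `x` (Hilbert's formula, Serre IV §1 Prop. 4: both sides equal `v_𝔓(𝔇_{L/F})`;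
here directly from `f'(x) = ∏_{γ ≠ 1} (x - γ x)` and `i_G(γ) = v_𝔓(γ x - x)`).
Ref: Serre, *Local Fields*, Ch. IV §1, Prop. 4. [cite: SerreLocalFields1979, Ch. IV §1 Prop. 4] -/
theorem emultiplicity_aeval_derivative_generator [Fintype F.fixingSubgroup]
    [DecidableEq F.fixingSubgroup] (h𝔓 : 𝔓 ≠ ⊥)
    (hF : F.fixingSubgroup ≤ 𝔓.inertia (L ≃ₐ[K] L))
    {x : integralClosure R L} {d : integralClosure R F}
    (hd : algebraMap (integralClosure R F) (integralClosure R L) d ∉ 𝔓)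
    (hgen : ∀ b : integralClosure R L, ∃ P : (integralClosure R F)[X], d • b = aeval x P) :
    emultiplicity 𝔓 (Ideal.span {aeval x (derivative (minpoly (integralClosure R F) x))}) =
      ∑ γ ∈ (Finset.univ : Finset F.fixingSubgroup).erase 1,
        lowerIndex 𝔓 (L ≃ₐ[K] L) (γ : L ≃ₐ[K] L) := by
  classical
  haveI : FaithfulSMul (L ≃ₐ[K] L) (integralClosure R L) := faithfulSMul_algEquiv_integralClosure R
  haveI hGal : IsGaloisGroup F.fixingSubgroup (integralClosure R F) (integralClosure R L) :=
    isGaloisGroup_fixingSubgroup_integralClosure R F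
  haveI : IsDedekindDomain (integralClosure R L) := integralClosure.isDedekindDomain R K L
  haveI : SMulCommClass F.fixingSubgroup (integralClosure R F) (integralClosure R L) :=
    hGal.commutes
  haveI h𝔓prime : 𝔓.IsPrime := Ideal.IsMaximal.isPrime inferInstance
  have hstab : ∀ g : F.fixingSubgroup, g • 𝔓 = 𝔓 := fun g =>
    (Ideal.inertia_le_stabilizer 𝔓) (hF g.2)
  have hi : ∀ g : F.fixingSubgroup,
      lowerIndex 𝔓 F.fixingSubgroup g = ordIdeal 𝔓 (g • x - x) :=
    lowerIndex_eq_ordIdeal h𝔓 hstab hd hgen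
  obtain ⟨-, -, hder⟩ := minpoly_generator R F 𝔓 h𝔓 hF hd hgen
  rw [hder, ordIdeal_prod h𝔓]
  refine Finset.sum_congr rfl fun g _ => ?_
  rw [ordIdeal_sub_comm, ← lowerIndex_subgroup 𝔓 F.fixingSubgroup g, hi g]
  rfl

end MinpolyGenerator

/-! ### Approximate inverses and order cancellation at `𝔓` -/

section Approx

variable {S : Type*} [CommRing S] (𝔓 : Ideal S)

/-- **Almost inverses modulo `𝔓ⁿ`.**  An element outside a maximal ideal `𝔓` is invertible
modulo every power of `𝔓`: `b b' ≡ 1 (mod 𝔓ⁿ)` for some `b'` (inverse mod `𝔓`, then the finite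
geometric series).  This replaces division by local units in the completion-free arguments below.
[folklore] -/
theorem exists_mul_sub_one_mem_pow [𝔓.IsMaximal] {b : S} (hb : b ∉ 𝔓) (n : ℕ) :
    ∃ b' : S, b * b' - 1 ∈ 𝔓 ^ n := by
  obtain ⟨c, i, hi, hc⟩ := Ideal.IsMaximal.exists_inv inferInstance hb
  -- `b c = 1 - i` with `i ∈ 𝔓`; take `b' = c (1 + i + ⋯ + i^{n-1})`
  refine ⟨c * ∑ k ∈ Finset.range n, i ^ k, ?_⟩
  have hbc : b * c = 1 - i := by linear_combination hc
  rw [← mul_assoc, hbc, mul_neg_geom_sum, sub_sub_cancel_left]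
  exact (𝔓 ^ n).neg_mem (Ideal.pow_mem_pow hi n)

variable [IsDedekindDomain S]

/-- Order cancellation: if `v_𝔓(ν) = k` and `ν t ∈ 𝔓 ^ (k + M)` then `t ∈ 𝔓 ^ M`. [folklore] -/
theorem mem_pow_of_mul_mem_pow_add [𝔓.IsPrime] (h𝔓 : 𝔓 ≠ ⊥) {ν t : S} {k M : ℕ}
    (hν : ordIdeal 𝔓 ν = k) (h : ν * t ∈ 𝔓 ^ (k + M)) : t ∈ 𝔓 ^ M := by
  rw [← le_ordIdeal_iff_mem_pow] at h ⊢
  rw [ordIdeal_mul h𝔓, hν, Nat.cast_add] at h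
  exact (ENat.add_le_add_iff_left (ENat.coe_ne_top k)).mp h

end Approx

/-! ### Serre V §3 Lemma 4: `Tr(𝔓^j) ⊆ 𝔓_F^{⌊(j+d)/|Γ|⌋}` -/

section TraceLemma

variable (F : IntermediateField K L) [IsDedekindDomain R] [IsFractionRing R K]
  [FiniteDimensional K L] [IsGalois K L]
  (𝔓 : Ideal (integralClosure R L)) [𝔓.IsMaximal]

/-- `Tr_Γ(y) = Σ_{γ ∈ Γ} γ y` is `Γ`-invariant, hence comes from `S_F`. [folklore] -/
theorem exists_algebraMap_eq_sum_smul [Fintype F.fixingSubgroup] (y : integralClosure R L) :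
    ∃ w : integralClosure R F, algebraMap (integralClosure R F) (integralClosure R L) w =
      ∑ γ : F.fixingSubgroup, (γ : L ≃ₐ[K] L) • y := by
  classical
  haveI : FaithfulSMul (L ≃ₐ[K] L) (integralClosure R L) := faithfulSMul_algEquiv_integralClosure R
  haveI hGal : IsGaloisGroup F.fixingSubgroup (integralClosure R F) (integralClosure R L) :=
    isGaloisGroup_fixingSubgroup_integralClosure R F
  haveI : Algebra.IsInvariant (integralClosure R F) (integralClosure R L) F.fixingSubgroup :=
    hGal.isInvariant
  refine Algebra.IsInvariant.isInvariant (A := integralClosure R F) (G := F.fixingSubgroup) _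
    fun g => ?_
  rw [Finset.smul_sum]
  exact Fintype.sum_bijective (g * ·) (Group.mulLeft_bijective g) _ _ fun h => by
    rw [Subgroup.coe_mul, mul_smul]; rfl


omit [IsDedekindDomain R] [IsFractionRing R K] [FiniteDimensional K L] [IsGalois K L] in
/-- In `L`: `Σ_{γ} γ y`, computed in `S` and then mapped to `L`, is `Σ_{γ} γ (y)`. [folklore] -/
theorem algebraMap_sum_smul [Fintype F.fixingSubgroup] (y : integralClosure R L) :
    algebraMap (integralClosure R L) L (∑ γ : F.fixingSubgroup, (γ : L ≃ₐ[K] L) • y) =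
      ∑ γ : F.fixingSubgroup, (γ : L ≃ₐ[K] L) ((y : integralClosure R L) : L) := by
  rw [map_sum]
  refine Finset.sum_congr rfl fun γ _ => ?_
  exact (integralClosure.coe_smul (γ : L ≃ₐ[K] L) y).trans (AlgEquiv.smul_def _ _)

omit [IsDedekindDomain R] [IsFractionRing R K] [FiniteDimensional K L] [IsGalois K L] in
/-- In `L`: `∏_{γ} γ y`, computed in `S` and then mapped to `L`, is `∏_{γ} γ (y)`. [folklore] -/
theorem algebraMap_prod_smul [Fintype F.fixingSubgroup] (y : integralClosure R L) :
    algebraMap (integralClosure R L) L (∏ γ : F.fixingSubgroup, (γ : L ≃ₐ[K] L) • y) =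
      ∏ γ : F.fixingSubgroup, (γ : L ≃ₐ[K] L) ((y : integralClosure R L) : L) := by
  rw [map_prod]
  refine Finset.prod_congr rfl fun γ _ => ?_
  exact (integralClosure.coe_smul (γ : L ≃ₐ[K] L) y).trans (AlgEquiv.smul_def _ _)

omit [IsDedekindDomain R] [IsFractionRing R K] [FiniteDimensional K L] [IsGalois K L] in
/-- The two ways `S_F → L` agree: through `S` and through `F`. [folklore] -/
theorem algebraMap_integralClosure_eq (z : integralClosure R F) :
    algebraMap (integralClosure R L) L (algebraMap (integralClosure R F) (integralClosure R L) z) =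
      algebraMap F L (algebraMap (integralClosure R F) F z) :=
  ((IsScalarTower.algebraMap_apply (integralClosure R F) (integralClosure R L) L z).symm).trans
    (IsScalarTower.algebraMap_apply (integralClosure R F) F L z)

set_option maxHeartbeats 800000 in
/-- **Serre V §3 Lemma 4 (inclusion), for a layer totally ramified at `𝔓`.**  Let
`Γ = Gal(L/F) ≤ T_𝔓`, `x`, `d` a local generator of `S` over `S_F` at `𝔓` (`d S ⊆ S_F[x]`,
`d ∉ 𝔓`), and `dd = v_𝔓(f'(x))` (`= v_𝔓(𝔇_{L/F}) = Σ_{γ ≠ 1} i_G(γ)`,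
`emultiplicity_aeval_derivative_generator`).  Then for `y ∈ 𝔓 ^ j`,
**`Tr_Γ(y) ∈ 𝔓 ^ (|Γ| ⌊(j + dd)/|Γ|⌋)`**, i.e. `Tr(𝔓^j) ⊆ 𝔓_F^r`, `r = ⌊(j+dd)/|Γ|⌋`
(Serre: `Tr(𝔭_L^n) ⊆ 𝔭_K^r ⇔ 𝔭_L^n ⊆ 𝔭_K^r 𝔇⁻¹`, Ch. III §3 Prop. 7).  Proof, global and
completion-free: with `(b) = 𝔓_F^r 𝔟`, `𝔓_F ∤ 𝔟`, `c ∈ 𝔟 ∖ 𝔓_F`, the element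
`θ = (c d / b) y ∈ L` satisfies `f'(x) θ ∈ S_F[x]` (as `y c f'(x) ∈ 𝔓^{j+dd} 𝔟 S ⊆ b S` and
`d S ⊆ S_F[x]`), so `θ` lies in the dual `f'(x)⁻¹ S_F[x]` of `S_F[x]` for the trace form (Euler,
Mathlib `traceForm_dualSubmodule_adjoin`), whence `(c d / b) Tr(y) = Tr(θ) ∈ S_F` and
`Tr(y) ∈ 𝔓_F^r` (`c d ∉ 𝔓_F`).
Ref: Serre, *Local Fields*, Ch. V §3, Lemma 4; Ch. III §3, Prop. 7; §6 Cor. 2 to Prop. 11.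
[cite: SerreLocalFields1979, Ch. V §3 Lemma 4] -/
theorem sum_smul_mem_pow_of_mem_pow [Fintype F.fixingSubgroup] [DecidableEq F.fixingSubgroup]
    (h𝔓 : 𝔓 ≠ ⊥) [Algebra.IsSeparable (R ⧸ 𝔓.under R) (integralClosure R L ⧸ 𝔓)]
    (hF : F.fixingSubgroup ≤ 𝔓.inertia (L ≃ₐ[K] L))
    {x : integralClosure R L} {d : integralClosure R F}
    (hd : algebraMap (integralClosure R F) (integralClosure R L) d ∉ 𝔓)
    (hgen : ∀ b : integralClosure R L, ∃ P : (integralClosure R F)[X], d • b = aeval x P)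
    {dd : ℕ} (hdd : emultiplicity 𝔓
      (Ideal.span {aeval x (derivative (minpoly (integralClosure R F) x))}) = dd)
    {j : ℕ} {y : integralClosure R L} (hy : y ∈ 𝔓 ^ j) :
    ∑ γ : F.fixingSubgroup, (γ : L ≃ₐ[K] L) • y ∈
      𝔓 ^ (Fintype.card F.fixingSubgroup * ((j + dd) / Fintype.card F.fixingSubgroup)) := by
  haveI : FaithfulSMul (L ≃ₐ[K] L) (integralClosure R L) := faithfulSMul_algEquiv_integralClosure R
  haveI hGal : IsGaloisGroup F.fixingSubgroup (integralClosure R F) (integralClosure R L) :=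
    isGaloisGroup_fixingSubgroup_integralClosure R F
  haveI : IsDedekindDomain (integralClosure R L) := integralClosure.isDedekindDomain R K L
  haveI : IsDedekindDomain (integralClosure R F) := integralClosure.isDedekindDomain R K F
  haveI : IsFractionRing (integralClosure R F) F :=
    integralClosure.isFractionRing_of_finite_extension K F
  haveI : IsFractionRing (integralClosure R L) L :=
    integralClosure.isFractionRing_of_finite_extension K L
  haveI : SMulCommClass F.fixingSubgroup (integralClosure R F) (integralClosure R L) :=
    hGal.commutes
  haveI : Algebra.IsInvariant (integralClosure R F) (integralClosure R L) F.fixingSubgroup :=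
    hGal.isInvariant
  haveI : Algebra.IsIntegral (integralClosure R F) (integralClosure R L) :=
    Algebra.IsInvariant.isIntegral _ _ F.fixingSubgroup
  haveI h𝔓prime : 𝔓.IsPrime := Ideal.IsMaximal.isPrime inferInstance
  set n := Fintype.card F.fixingSubgroup with hn
  set r := (j + dd) / n with hr
  have hnr : n * r ≤ j + dd := Nat.mul_div_le (j + dd) n
  set δ := aeval x (derivative (minpoly (integralClosure R F) x)) with hδ
  have hδmem : δ ∈ 𝔓 ^ dd := le_ordIdeal_iff_mem_pow.mp (le_of_eq hdd.symm)
  have hδ0 : δ ≠ 0 := fun h0 => by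
    rw [h0, ordIdeal_zero] at hdd
    exact ENat.top_ne_coe dd hdd
  -- the prime `𝔓_F` below `𝔓`, and `(b) = 𝔓_F^r 𝔟`, `c ∈ 𝔟 ∖ 𝔓_F`
  set 𝔓F := 𝔓.under (integralClosure R F) with h𝔓Fdef
  haveI h𝔓Fmax : 𝔓F.IsMaximal := Ideal.IsMaximal.under _ 𝔓
  have h𝔓F : 𝔓F ≠ ⊥ := Ideal.IsIntegral.comap_ne_bot _ h𝔓
  have h𝔓Fprime : Prime 𝔓F := Ideal.prime_of_isPrime h𝔓F inferInstance
  have hlt : 𝔓F ^ (r + 1) < 𝔓F ^ r :=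
    Ideal.pow_right_strictAnti 𝔓F h𝔓F (Ideal.IsMaximal.ne_top inferInstance) (Nat.lt_succ_self r)
  obtain ⟨bb, hbb, hbb'⟩ := SetLike.exists_of_lt hlt
  have hbb0 : bb ≠ 0 := fun h => hbb' (h ▸ Submodule.zero_mem _)
  have hmult : emultiplicity 𝔓F (Ideal.span {bb}) = r :=
    emultiplicity_eq_coe.mpr ⟨Ideal.dvd_span_singleton.mpr hbb, fun h =>
      hbb' (Ideal.dvd_span_singleton.mp h)⟩
  have hfinm : FiniteMultiplicity 𝔓F (Ideal.span {bb}) :=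
    finiteMultiplicity_iff_emultiplicity_ne_top.mpr (by rw [hmult]; exact ENat.coe_ne_top r)
  obtain ⟨𝔟, h𝔟, h𝔟𝔓⟩ := hfinm.exists_eq_pow_mul_and_not_dvd
  have hmr : multiplicity 𝔓F (Ideal.span {bb}) = r := by
    have h := hfinm.emultiplicity_eq_multiplicity
    rw [hmult] at h
    exact_mod_cast h.symm
  rw [hmr] at h𝔟
  obtain ⟨cc, hcc, hcc𝔓⟩ : ∃ cc ∈ 𝔟, cc ∉ 𝔓F :=
    Set.not_subset.mp fun h => h𝔟𝔓 (Ideal.dvd_iff_le.mpr h)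
  -- `u ∈ S` with `b u = y c f'(x)`, and `d u = Pu(x)`
  have hmap := map_under_eq_pow_card R F 𝔓 h𝔓 hF
  have hmem : y * algebraMap _ _ cc * δ ∈
      (Ideal.span {bb}).map (algebraMap (integralClosure R F) (integralClosure R L)) := by
    rw [h𝔟, Ideal.map_mul, Ideal.map_pow,
      show Ideal.map (algebraMap (integralClosure R F) (integralClosure R L)) 𝔓F = 𝔓 ^ n from hmap,
      ← pow_mul]
    have h1 : y * δ ∈ 𝔓 ^ (n * r) := by
      refine Ideal.pow_le_pow_right hnr ?_
      rw [pow_add]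
      exact Ideal.mul_mem_mul hy hδmem
    have h2 : algebraMap (integralClosure R F) (integralClosure R L) cc ∈
        𝔟.map (algebraMap (integralClosure R F) (integralClosure R L)) :=
      Ideal.mem_map_of_mem _ hcc
    rw [show y * algebraMap _ _ cc * δ = y * δ * algebraMap _ _ cc by ring]
    exact Ideal.mul_mem_mul h1 h2
  rw [Ideal.map_span, Set.image_singleton, Ideal.mem_span_singleton'] at hmem
  obtain ⟨u, hu⟩ := hmem
  obtain ⟨Pu, hPu⟩ := hgen u
  -- the minimal polynomial of `x` and Euler's description of the dual of `S_F[x]`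
  obtain ⟨-, hxtop, -⟩ := minpoly_generator R F 𝔓 h𝔓 hF hd hgen
  have hxintS : IsIntegral (integralClosure R F) x := Algebra.IsIntegral.isIntegral x
  have hxint : IsIntegral (integralClosure R F) ((x : integralClosure R L) : L) := hxintS.algebraMap
  have hdual := traceForm_dualSubmodule_adjoin (integralClosure R F) F (L := L) hxtop hxint
  have hδL : aeval ((x : integralClosure R L) : L) (derivative (minpoly F ((x : integralClosure R L) : L))) =
      ((δ : integralClosure R L) : L) := by
    rw [minpoly.isIntegrallyClosed_eq_field_fractions' F hxint, derivative_map, aeval_map_algebraMap,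
      show ((x : integralClosure R L) : L) = algebraMap (integralClosure R L) L x from rfl,
      minpoly.algebraMap_eq (FaithfulSMul.algebraMap_injective (integralClosure R L) L) x,
      aeval_algebraMap_apply, hδ]
    rfl
  have hδL0 : ((δ : integralClosure R L) : L) ≠ 0 := fun h =>
    hδ0 (FaithfulSMul.algebraMap_injective (integralClosure R L) L (by rw [map_zero]; exact h))
  have hbbF0 : algebraMap (integralClosure R F) F bb ≠ 0 := fun h =>
    hbb0 (IsFractionRing.injective (integralClosure R F) F (by rw [h, map_zero]))
  -- the element `θ = (c d / b) y` lies in the dual of `S_F[x]`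
  set κ : F := algebraMap (integralClosure R F) F (cc * d) / algebraMap (integralClosure R F) F bb
    with hκ
  set θ : L := κ • ((y : integralClosure R L) : L) with hθ
  have hδθ : ((δ : integralClosure R L) : L) * θ = ((d • u : integralClosure R L) : L) := by
    have hu' : ((u : integralClosure R L) : L) * algebraMap (integralClosure R F) L bb =
        (y : L) * algebraMap (integralClosure R F) L cc * (δ : L) := by
      have h := congrArg (algebraMap (integralClosure R L) L) hu
      rw [map_mul, map_mul, map_mul, ← IsScalarTower.algebraMap_apply,
        ← IsScalarTower.algebraMap_apply] at h
      exact h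
    have hbbL0 : algebraMap (integralClosure R F) L bb ≠ 0 := by
      rw [IsScalarTower.algebraMap_apply (integralClosure R F) F L]
      exact (_root_.map_ne_zero _).mpr hbbF0
    have hrhs : ((d • u : integralClosure R L) : L) =
        algebraMap (integralClosure R F) L d * (u : L) := by
      rw [Algebra.smul_def, show ((algebraMap (integralClosure R F) (integralClosure R L) d * u :
          integralClosure R L) : L) = algebraMap (integralClosure R L) L
          (algebraMap (integralClosure R F) (integralClosure R L) d * u) from rfl, map_mul,
        ← IsScalarTower.algebraMap_apply]
      rfl
    have hlhs : θ = algebraMap (integralClosure R F) L cc * algebraMap (integralClosure R F) L d /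
        algebraMap (integralClosure R F) L bb * (y : L) := by
      rw [hθ, hκ, Algebra.smul_def, map_mul, map_div₀, map_mul, ← IsScalarTower.algebraMap_apply,
        ← IsScalarTower.algebraMap_apply, ← IsScalarTower.algebraMap_apply]
    rw [hrhs, hlhs]
    field_simp
    linear_combination (-(algebraMap (integralClosure R F) L d)) * hu'
  have hθdual : θ ∈ (Algebra.traceForm F L).dualSubmodule
      (Subalgebra.toSubmodule (Algebra.adjoin (integralClosure R F) {((x : integralClosure R L) : L)})) := by
    rw [hdual, hδL]
    refine (Submodule.mem_smul_pointwise_iff_exists _ _ _).mpr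
      ⟨((δ : integralClosure R L) : L) * θ, ?_, ?_⟩
    · rw [hδθ, hPu, Subalgebra.mem_toSubmodule,
        show ((aeval x Pu : integralClosure R L) : L) = algebraMap (integralClosure R L) L (aeval x Pu)
          from rfl, ← aeval_algebraMap_apply]
      exact aeval_mem_adjoin_singleton _ _
    · rw [smul_eq_mul, ← mul_assoc, inv_mul_cancel₀ hδL0, one_mul]
  -- hence `Tr(θ) ∈ S_F`
  have h1mem : (1 : L) ∈ Subalgebra.toSubmodule
      (Algebra.adjoin (integralClosure R F) {((x : integralClosure R L) : L)}) :=
    Subalgebra.one_mem _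
  have htr := (LinearMap.BilinForm.mem_dualSubmodule _).mp hθdual 1 h1mem
  rw [Algebra.traceForm_apply, mul_one, Submodule.mem_one] at htr
  obtain ⟨a, ha⟩ := htr
  -- `Tr(y) = w ∈ S_F` and `Tr(θ) = κ Tr(y)`
  obtain ⟨w, hw⟩ := exists_algebraMap_eq_sum_smul R F y
  have htry : Algebra.trace F L ((y : integralClosure R L) : L) =
      algebraMap (integralClosure R F) F w := by
    apply (algebraMap F L).injective
    rw [← sum_smul_eq_algebraMap_trace, ← algebraMap_sum_smul R F y, ← hw,
      algebraMap_integralClosure_eq]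
  have hθtr : Algebra.trace F L θ = κ * algebraMap (integralClosure R F) F w := by
    rw [hθ, LinearMap.map_smul, smul_eq_mul, htry]
  -- so `a b = c d w` in `S_F`, and `w ∈ 𝔓_F ^ r`
  have hab : a * bb = cc * d * w := by
    apply IsFractionRing.injective (integralClosure R F) F
    rw [map_mul, ha, hθtr, hκ, map_mul, map_mul, map_mul]
    field_simp
  have hd𝔓F : d ∉ 𝔓F := fun h => hd h
  have hcd : cc * d ∉ 𝔓F := fun h =>
    ((Ideal.IsMaximal.isPrime inferInstance).mem_or_mem h).elim hcc𝔓 hd𝔓F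
  have hw𝔓 : w ∈ 𝔓F ^ r := by
    refine mem_pow_of_mul_mem_pow 𝔓F h𝔓F hcd ?_
    rw [← hab, mul_comm]
    exact Ideal.mul_mem_right _ _ hbb
  rw [← hw]
  have h := Ideal.mem_map_of_mem (algebraMap (integralClosure R F) (integralClosure R L)) hw𝔓
  rwa [Ideal.map_pow,
    show Ideal.map (algebraMap (integralClosure R F) (integralClosure R L)) 𝔓F = 𝔓 ^ n from hmap,
    ← pow_mul] at h

end TraceLemma

/-! ### Euler's formula `Tr_{L/F}(x^{n-1}/f'(x)) = 1` and Serre V §3 Lemma 4, equality half -/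

section Euler

/-- **Euler's formula.**  If `x` generates the finite separable extension `L/F` of degree `n`,
then `Tr_{L/F}(x^{n-1}/f'(x)) = 1` (`f` the minimal polynomial of `x`): the dual basis of
`1, x, …, x^{n-1}` for the trace form is `b_i/f'(x)` with `f/(X - x) = Σ b_i X^i`, `b_{n-1} = 1`
(Mathlib `Module.Basis.traceDual_powerBasis_eq`).
Ref: Serre, *Local Fields*, Ch. III §6, Lemma 2 (Euler); Mathlib. [folklore] -/
theorem trace_pow_div_aeval_derivative_eq_one {F' L' : Type*} [Field F'] [Field L'] [Algebra F' L']
    [FiniteDimensional F' L'] [Algebra.IsSeparable F' L'] {x : L'}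
    (hx : Algebra.adjoin F' {x} = ⊤) :
    Algebra.trace F' L' (x ^ (Module.finrank F' L' - 1) / aeval x (derivative (minpoly F' x))) = 1 := by
  classical
  have hKx : IsIntegral F' x := Algebra.IsIntegral.isIntegral x
  let pb : PowerBasis F' L' := (Algebra.adjoin.powerBasis' hKx).map
    ((Subalgebra.equivOfEq _ _ hx).trans Subalgebra.topEquiv)
  have pbgen : pb.gen = x := by simp [pb]
  have hdim : pb.dim = (minpoly F' x).natDegree := by
    rw [PowerBasis.map_dim, Algebra.adjoin.powerBasis'_dim]
  have hfin : Module.finrank F' L' = pb.dim := pb.finrank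
  have hpos : 0 < pb.dim := pb.dim_pos
  set i : Fin pb.dim := ⟨pb.dim - 1, Nat.sub_lt hpos Nat.one_pos⟩ with hi
  have h1 := Module.Basis.trace_traceDual_mul pb.basis i i
  rw [if_pos rfl, Module.Basis.traceDual_powerBasis_eq, PowerBasis.coe_basis] at h1
  simp only [pbgen] at h1
  have hcoeff : (minpolyDiv F' x).coeff (i : ℕ) = 1 := by
    have hnat : (minpolyDiv F' x).natDegree = (i : ℕ) := by
      have h := natDegree_minpolyDiv_succ hKx (S := L')
      rw [← hdim] at h
      change _ = pb.dim - 1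
      omega
    rw [← hnat]
    exact (minpolyDiv_monic hKx).coeff_natDegree
  rw [hcoeff, one_div, inv_mul_eq_div] at h1
  rw [hfin]
  exact h1

end Euler

section TraceLemma2

variable (F : IntermediateField K L) [IsDedekindDomain R] [IsFractionRing R K]
  [FiniteDimensional K L] [IsGalois K L]
  (𝔓 : Ideal (integralClosure R L)) [𝔓.IsMaximal]

/-- `f'(x)` computed over `S_F` and mapped to `L` is `f'(x)` computed over `F` (the minimal
polynomials agree, `S_F` being integrally closed).  Ref: Mathlib
`minpoly.isIntegrallyClosed_eq_field_fractions'`. [folklore] -/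
theorem aeval_derivative_minpoly_coe (x : integralClosure R L) :
    aeval ((x : integralClosure R L) : L) (derivative (minpoly F ((x : integralClosure R L) : L))) =
      ((aeval x (derivative (minpoly (integralClosure R F) x)) : integralClosure R L) : L) := by
  haveI : IsDedekindDomain (integralClosure R F) := integralClosure.isDedekindDomain R K F
  haveI : IsFractionRing (integralClosure R F) F :=
    integralClosure.isFractionRing_of_finite_extension K F
  haveI : Algebra.IsIntegral (integralClosure R F) (integralClosure R L) :=
    integralClosure_isIntegral R F
  have hxint : IsIntegral (integralClosure R F) ((x : integralClosure R L) : L) :=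
    (Algebra.IsIntegral.isIntegral (R := integralClosure R F) x).algebraMap
  rw [minpoly.isIntegrallyClosed_eq_field_fractions' F hxint, derivative_map, aeval_map_algebraMap,
    show ((x : integralClosure R L) : L) = algebraMap (integralClosure R L) L x from rfl,
    minpoly.algebraMap_eq (FaithfulSMul.algebraMap_injective (integralClosure R L) L) x,
    aeval_algebraMap_apply]
  rfl

set_option maxHeartbeats 800000 in
/-- **Serre V §3 Lemma 4 (equality half, approximate form), for a layer totally ramified at `𝔓`.**
With notation as in `sum_smul_mem_pow_of_mem_pow` and a local generator `x ∈ 𝔓`: for every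
`z₀ ∈ 𝔓_F ^ r`, `r = ⌊(j + dd)/|Γ|⌋`, and every `M`, there is `y ∈ 𝔓 ^ j` with
**`Tr_Γ(y) ≡ z₀ (mod 𝔓 ^ M)`** — so `Tr` induces a surjection of `𝔓^j` onto `𝔓_F^r` modulo any
higher power (Serre: `Tr(𝔭_L^j) = 𝔭_K^r` exactly, in the complete case).  Proof: by Euler's formula
`y' = z₀ x^{n-1}/f'(x) ∈ L` has trace exactly `z₀` and `v_𝔓(y') ≥ j` (`x ∈ 𝔓`); writing
`y' = n''/ν` with `ν = N_Γ(f'(x)) ∈ S_F`, `v_𝔓(ν) = |Γ| dd`, we solve `ν y ≡ n''` to high order in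
`S` (`ν S = 𝔓^{|Γ| dd} 𝔠`, `𝔓 ∤ 𝔠`, an almost-inverse of some `b₁ ∈ 𝔠 ∖ 𝔓`) and bound
`ν (Tr(y) - z₀) = Tr(ν y - n'')` by the inclusion half.
Ref: Serre, *Local Fields*, Ch. V §3, Lemma 4; Ch. III §6 Lemma 2 (Euler).
[cite: SerreLocalFields1979, Ch. V §3 Lemma 4] -/
theorem exists_sum_smul_sub_mem_pow [Fintype F.fixingSubgroup] [DecidableEq F.fixingSubgroup]
    (h𝔓 : 𝔓 ≠ ⊥) [Algebra.IsSeparable (R ⧸ 𝔓.under R) (integralClosure R L ⧸ 𝔓)]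
    (hF : F.fixingSubgroup ≤ 𝔓.inertia (L ≃ₐ[K] L))
    {x : integralClosure R L} {d : integralClosure R F} (hx𝔓 : x ∈ 𝔓)
    (hd : algebraMap (integralClosure R F) (integralClosure R L) d ∉ 𝔓)
    (hgen : ∀ b : integralClosure R L, ∃ P : (integralClosure R F)[X], d • b = aeval x P)
    {dd : ℕ} (hdd : emultiplicity 𝔓
      (Ideal.span {aeval x (derivative (minpoly (integralClosure R F) x))}) = dd)
    {j : ℕ} {z₀ : integralClosure R F}
    (hz₀ : z₀ ∈ 𝔓.under (integralClosure R F) ^ ((j + dd) / Fintype.card F.fixingSubgroup))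
    (M : ℕ) :
    ∃ y ∈ 𝔓 ^ j, ∑ γ : F.fixingSubgroup, (γ : L ≃ₐ[K] L) • y -
      algebraMap (integralClosure R F) (integralClosure R L) z₀ ∈ 𝔓 ^ M := by
  haveI : FaithfulSMul (L ≃ₐ[K] L) (integralClosure R L) := faithfulSMul_algEquiv_integralClosure R
  haveI hGal : IsGaloisGroup F.fixingSubgroup (integralClosure R F) (integralClosure R L) :=
    isGaloisGroup_fixingSubgroup_integralClosure R F
  haveI : IsDedekindDomain (integralClosure R L) := integralClosure.isDedekindDomain R K L
  haveI : IsDedekindDomain (integralClosure R F) := integralClosure.isDedekindDomain R K F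
  haveI : IsFractionRing (integralClosure R F) F :=
    integralClosure.isFractionRing_of_finite_extension K F
  haveI : IsFractionRing (integralClosure R L) L :=
    integralClosure.isFractionRing_of_finite_extension K L
  haveI : SMulCommClass F.fixingSubgroup (integralClosure R F) (integralClosure R L) :=
    hGal.commutes
  haveI : Algebra.IsInvariant (integralClosure R F) (integralClosure R L) F.fixingSubgroup :=
    hGal.isInvariant
  haveI : Algebra.IsIntegral (integralClosure R F) (integralClosure R L) :=
    Algebra.IsInvariant.isIntegral _ _ F.fixingSubgroup
  haveI h𝔓prime : 𝔓.IsPrime := Ideal.IsMaximal.isPrime inferInstance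
  have h𝔓pr : Prime 𝔓 := Ideal.prime_of_isPrime h𝔓 inferInstance
  have hstab : ∀ g : F.fixingSubgroup, g • 𝔓 = 𝔓 := fun g =>
    (Ideal.inertia_le_stabilizer 𝔓) (hF g.2)
  set n := Fintype.card F.fixingSubgroup with hn
  clear_value n
  have hnpos : 0 < n := by rw [hn]; exact Fintype.card_pos
  set r := (j + dd) / n with hr
  clear_value r
  have hnr' : j + dd < n * r + n := by
    have h1 : n * r + (j + dd) % n = j + dd := by rw [hr]; exact Nat.div_add_mod (j + dd) n
    have h2 := Nat.mod_lt (j + dd) hnpos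
    omega
  set δ := aeval x (derivative (minpoly (integralClosure R F) x)) with hδ
  have hδmem : δ ∈ 𝔓 ^ dd := le_ordIdeal_iff_mem_pow.mp (le_of_eq hdd.symm)
  have hδ0 : δ ≠ 0 := fun h0 => by
    rw [h0, ordIdeal_zero] at hdd
    exact ENat.top_ne_coe dd hdd
  -- `δ' = ∏_{γ ≠ 1} γ f'(x)`, `ν = N(f'(x)) = f'(x) δ'`, `v(ν) = n dd`
  set δ' := ∏ γ ∈ (Finset.univ : Finset F.fixingSubgroup).erase 1, (γ : L ≃ₐ[K] L) • δ with hδ'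
  set ν := ∏ γ : F.fixingSubgroup, (γ : L ≃ₐ[K] L) • δ with hν
  have hνeq : ν = δ * δ' := by
    rw [hν, hδ', ← Finset.mul_prod_erase _ _ (Finset.mem_univ (1 : F.fixingSubgroup))]
    simp
  have hordγ : ∀ γ : F.fixingSubgroup, ordIdeal 𝔓 ((γ : L ≃ₐ[K] L) • δ) = dd := fun γ => by
    rw [show (γ : L ≃ₐ[K] L) • δ = γ • δ from rfl, ordIdeal_smul (hstab γ), hdd]
  have hordν : ordIdeal 𝔓 ν = (n * dd : ℕ) := by
    rw [hν, ordIdeal_prod h𝔓, Finset.sum_congr rfl fun γ _ => hordγ γ, Finset.sum_const,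
      Finset.card_univ, hn, nsmul_eq_mul, Nat.cast_mul]
  have hδ'mem : δ' ∈ 𝔓 ^ ((n - 1) * dd) := by
    rw [← le_ordIdeal_iff_mem_pow, hδ', ordIdeal_prod h𝔓,
      Finset.sum_congr rfl fun γ _ => hordγ γ, Finset.sum_const, Finset.card_erase_of_mem
        (Finset.mem_univ _), Finset.card_univ, hn, nsmul_eq_mul, Nat.cast_mul]
  have hνinv : ∀ g : F.fixingSubgroup, g • ν = ν := fun g => by
    rw [hν, Finset.smul_prod']
    exact Fintype.prod_bijective (g * ·) (Group.mulLeft_bijective g) _ _ fun h => by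
      rw [Subgroup.coe_mul, mul_smul]; rfl
  -- `n'' = z₀ x^{n-1} δ' ∈ 𝔓 ^ (j + n dd)`
  set n'' := algebraMap (integralClosure R F) (integralClosure R L) z₀ * x ^ (n - 1) * δ' with hn''
  have hmap := map_under_eq_pow_card R F 𝔓 h𝔓 hF
  have hz₀S : algebraMap (integralClosure R F) (integralClosure R L) z₀ ∈ 𝔓 ^ (n * r) := by
    have h := Ideal.mem_map_of_mem (algebraMap (integralClosure R F) (integralClosure R L)) hz₀
    rwa [Ideal.map_pow, hmap, ← hn, ← pow_mul] at h
  have hn''mem : n'' ∈ 𝔓 ^ (j + n * dd) := by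
    have h1 : algebraMap (integralClosure R F) (integralClosure R L) z₀ * x ^ (n - 1) * δ' ∈
        𝔓 ^ (n * r + (n - 1) + (n - 1) * dd) := by
      rw [pow_add, pow_add]
      exact Ideal.mul_mem_mul (Ideal.mul_mem_mul hz₀S (Ideal.pow_mem_pow hx𝔓 _)) hδ'mem
    refine Ideal.pow_le_pow_right ?_ h1
    have : (n - 1) * dd + dd = n * dd := by
      conv_rhs => rw [show n = (n - 1) + 1 by omega, add_mul, one_mul]
    omega
  -- `ν S = 𝔓 ^ (n dd) 𝔠` with `𝔓 ∤ 𝔠`; `b₁ ∈ 𝔠 ∖ 𝔓`; `a` with `a ν = b₁ n''`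
  have hfinm : FiniteMultiplicity 𝔓 (Ideal.span {ν}) :=
    finiteMultiplicity_iff_emultiplicity_ne_top.mpr (by rw [hordν]; exact ENat.coe_ne_top _)
  obtain ⟨𝔠, h𝔠, h𝔠𝔓⟩ := hfinm.exists_eq_pow_mul_and_not_dvd
  have hmr : multiplicity 𝔓 (Ideal.span {ν}) = n * dd := by
    have h := hfinm.emultiplicity_eq_multiplicity
    rw [hordν] at h
    exact_mod_cast h.symm
  rw [hmr] at h𝔠
  obtain ⟨b₁, hb₁, hb₁𝔓⟩ : ∃ b₁ ∈ 𝔠, b₁ ∉ 𝔓 :=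
    Set.not_subset.mp fun h => h𝔠𝔓 (Ideal.dvd_iff_le.mpr h)
  have hbn : b₁ * n'' ∈ Ideal.span {ν} := by
    rw [h𝔠, mul_comm b₁ n'']
    exact Ideal.mul_mem_mul (Ideal.pow_le_pow_right (Nat.le_add_left _ _) hn''mem) hb₁
  obtain ⟨a, ha⟩ := Ideal.mem_span_singleton'.mp hbn
  -- almost-inverse of `b₁`, and `y = a b₁'`
  obtain ⟨b₁', hb₁'⟩ := exists_mul_sub_one_mem_pow 𝔓 hb₁𝔓 (M + n * dd + n)
  refine ⟨a * b₁', ?_, ?_⟩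
  · -- `ν y ∈ 𝔓 ^ (n dd + j)`, so `y ∈ 𝔓 ^ j`
    refine mem_pow_of_mul_mem_pow_add 𝔓 h𝔓 hordν ?_
    have key : ν * (a * b₁') = n'' + (b₁ * b₁' - 1) * n'' := by linear_combination b₁' * ha
    rw [key, add_comm (n * dd) j]
    exact Ideal.add_mem _ hn''mem (Ideal.mul_mem_left _ _ hn''mem)
  · -- the trace estimate
    set e := ν * (a * b₁') - n'' with he
    have hemem : e ∈ 𝔓 ^ (M + n * dd + n) := by
      have key : e = (b₁ * b₁' - 1) * n'' := by
        rw [he]; linear_combination b₁' * ha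
      rw [key]
      exact Ideal.mul_mem_right _ _ hb₁'
    have hTre := sum_smul_mem_pow_of_mem_pow R F 𝔓 h𝔓 hF hd hgen hdd hemem
    -- `Tr(e) = ν (Tr(y) - z₀)`: the Euler computation, in `L`
    have hsum : ∑ γ : F.fixingSubgroup, (γ : L ≃ₐ[K] L) • e =
        ν * (∑ γ : F.fixingSubgroup, (γ : L ≃ₐ[K] L) • (a * b₁') -
          algebraMap (integralClosure R F) (integralClosure R L) z₀) := by
      have hsume : ∑ γ : F.fixingSubgroup, (γ : L ≃ₐ[K] L) • e =
          ν * ∑ γ : F.fixingSubgroup, (γ : L ≃ₐ[K] L) • (a * b₁') -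
            ∑ γ : F.fixingSubgroup, (γ : L ≃ₐ[K] L) • n'' := by
        rw [he, Finset.mul_sum, ← Finset.sum_sub_distrib]
        refine Finset.sum_congr rfl fun γ _ => ?_
        rw [smul_sub, smul_mul', show (γ : L ≃ₐ[K] L) • ν = γ • ν from rfl, hνinv γ]
      rw [hsume, mul_sub]
      congr 1
      -- `Σ γ n'' = ν z₀` by Euler, checked in `L`
      apply FaithfulSMul.algebraMap_injective (integralClosure R L) L
      obtain ⟨-, hxtop, -⟩ := minpoly_generator R F 𝔓 h𝔓 hF hd hgen
      have hfin : Module.finrank F L = n := by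
        rw [hn, ← Nat.card_eq_fintype_card]; exact (IsGalois.card_fixingSubgroup_eq_finrank F).symm
      have hEuler := trace_pow_div_aeval_derivative_eq_one (F' := F) (L' := L) hxtop
      rw [hfin, aeval_derivative_minpoly_coe R F x, ← hδ] at hEuler
      have hδL0 : ((δ : integralClosure R L) : L) ≠ 0 := fun h =>
        hδ0 (FaithfulSMul.algebraMap_injective (integralClosure R L) L (by rw [map_zero]; exact h))
      -- `n'' = ν Y` with `Y = z₀ x^{n-1}/f'(x)`
      set Y : L := algebraMap (integralClosure R F) F z₀ •
        (((x : integralClosure R L) : L) ^ (n - 1) / ((δ : integralClosure R L) : L)) with hY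
      have hc : ∀ z : integralClosure R L, ((z : integralClosure R L) : L) =
          algebraMap (integralClosure R L) L z := fun _ => rfl
      have hn''L : algebraMap (integralClosure R L) L n'' = algebraMap (integralClosure R L) L ν * Y := by
        rw [hY, hn'', hνeq, Algebra.smul_def, map_mul, map_mul, map_mul, map_pow,
          algebraMap_integralClosure_eq]
        simp only [hc] at hδL0 ⊢
        field_simp
      have hγν : ∀ γ : F.fixingSubgroup,
          (γ : L ≃ₐ[K] L) (algebraMap (integralClosure R L) L ν) = algebraMap (integralClosure R L) L ν :=
        fun γ => by
          rw [show algebraMap (integralClosure R L) L ν = ((ν : integralClosure R L) : L) from rfl,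
            ← AlgEquiv.smul_def, ← integralClosure.coe_smul, show (γ : L ≃ₐ[K] L) • ν = γ • ν from rfl,
            hνinv γ]
      rw [algebraMap_sum_smul R F n'', map_mul, algebraMap_integralClosure_eq,
        show ((n'' : integralClosure R L) : L) = algebraMap (integralClosure R L) L n'' from rfl, hn''L]
      simp_rw [map_mul, hγν]
      rw [← Finset.mul_sum, sum_smul_eq_algebraMap_trace, hY, LinearMap.map_smul, hEuler,
        Algebra.smul_def, mul_one]
      rfl
    have h2 : ν * (∑ γ : F.fixingSubgroup, (γ : L ≃ₐ[K] L) • (a * b₁') -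
        algebraMap (integralClosure R F) (integralClosure R L) z₀) ∈ 𝔓 ^ (n * dd + M) := by
      rw [← hsum]
      refine Ideal.pow_le_pow_right ?_ hTre
      have h1 := Nat.div_add_mod (M + n * dd + n + dd) n
      have h2 := Nat.mod_lt (M + n * dd + n + dd) hnpos
      rw [← hn]
      omega
    exact mem_pow_of_mul_mem_pow_add 𝔓 h𝔓 hordν h2

end TraceLemma2

end Literature.NumberTheory.GaloisRepresentations

end
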